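import Summits.ValiantsHypothesis.ValiantsHypothesis.Theorems.LacunarySymmetroidMatrixDescartesDoorA26WallBubblingSignWord

/-!
# `DoorA26` / line `wall_bubbling` — THE TRIPLE-ZERO LIFT: a zero of order three unfolds into three simple zeros under the Q-shift

HONEST FRAMING.  Object-search cell `pub-symmetroid`, crux `Theses.LacunarySymmetroid.DoorA26` (stmt-ValiantsHypothesis-19979; OPEN, typed,
never asserted).  W2 seat val-sym-door-p1 g18, file #49; def-free helper for obligation (R) of `Cruxes/DoorA26/Lines/wall_bubbling.lean`, continuing
#46 `…SignWord` (the Q-lift: letters `S_l + η T_l`, `det(P + ηQ) = det P + η·polar + η² det Q`).  The Q-lift and its dual form (#47) handle DOUBLE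
zeros at fixed virtual abscissae; a zero of multiplicity THREE cannot be handled at fixed abscissae (the two extra sign alternations it must produce live
at distance `~√η` from it).  This file supplies the missing piece.

WHAT IS HERE.  §1 `eventually_pencilShift_signs`: the sign bookkeeping of #46 for ALL small `η > 0` (eventually form).  §2 `cubic_unfolding_signs` — an
abstract real-variable lemma: if `|F(s) − a s³| ≤ M s⁴`, `|G(s) − b s| ≤ M s²`, `|H(s)| ≤ M` for `|s| ≤ ρ` and `λ > 0` has `a(a + λb) < 0`, then for all
small `s > 0`, with `η = λ s²`, `0 < a·(F + ηG + η²H)(−s)` and `a·(F + ηG + η²H)(s) < 0` (local model `a s³ + η b s = (a + λb) s³` at `±s`; all error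
terms are `O(s⁴)`).  §3 `card_le_ncard_zero_of_disjoint_brackets`: a continuous function with a sign change on each of finitely many pairwise disjoint
open intervals (UNORDERED index) has at least that many zeros.  §4 ★ `mem_twentyLocus_of_tripleZero`: `19` increasing abscissae `τ` with alternating
virtual signs `κ` and the Q-lift sign data of #46 at each of them; in one gap `(τ_{j⋆}, τ_{j⋆+1})` a point `t⋆` where `det P`, `polar(P,Q)`, `det Q`
obey the cubic Taylor bounds above (a zero of order three of `det P` at which the push vanishes to first order with slope `b`), `a κ_{j⋆} < 0`,
`a(a + λb) < 0` ⇒ `δ ∈ TwentyLocus`: the `17` other gaps and the three sub-gaps `(τ_{j⋆}, t⋆−s)`, `(t⋆−s, t⋆+s)`, `(t⋆+s, τ_{j⋆+1})` are twenty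
disjoint sign-change brackets of `det(P + ηQ)`.  The Taylor bounds are HYPOTHESES (they hold for every real-analytic `P, Q` at a zero of exact order
three with `polar(t⋆) = 0`; deriving them from smoothness is routine and not done here); `λ = −2a/b` works whenever `ab < 0`.
READING for (R): with #46–#48 (double zeros ⇒ lift unless BALANCED, ≥ 7 touches) and this file (triple zeros ⇒ lift when some `Q` kills the push at `t⋆`
and tilts the cubic, compatibly with the other abscissae), the single-cluster multiplicity residual is reduced to balance-type coincidences and zeros of
order ≥ 4.  Nothing here bears on `DoorA26`, `DoorA34`, (W)/(M)/(R), `MatrixDescartes` (18050) or `VP ≠ VNP`; registers unchanged.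

[folklore] elementary real analysis (cubic unfolding, intermediate value theorem); [this work] the packaging.
-/

-- `Summit.ValiantsHypothesis.ValiantsHypothesis.…` repeats a component by the D-0017 layout
-- (single-conjunct summit), which the `dupNamespace` linter flags; the name is mandated.
set_option linter.dupNamespace false

namespace Summit.ValiantsHypothesis.ValiantsHypothesis.Theorems.LacunarySymmetroidMatrixDescartes.WallBubbling

open Finset Filter Topology
open Bubbling (TwentyLocus)
open Census.RealExp (ncard_rpow_eq_ncard_exp exists_zero_of_mul_neg continuous_det_expPencil)

/-! ## §1 Sign bookkeeping, eventually form -/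

/-- The sign bookkeeping of the Q-shift holds for ALL sufficiently small `η > 0` (eventually form of #46's `exists_pencilShift_signs`). [folklore] -/
theorem eventually_pencilShift_signs {N : ℕ} (D B C κ : Fin N → ℝ)
    (hκ : ∀ j, 0 < κ j * D j ∨ (D j = 0 ∧ 0 < κ j * B j) ∨ (D j = 0 ∧ B j = 0 ∧ 0 < κ j * C j)) :
    ∀ᶠ η in 𝓝[>] (0 : ℝ), ∀ j, 0 < κ j * (D j + η * B j + η ^ 2 * C j) := by
  have hev : ∀ j, ∀ᶠ η in 𝓝[>] (0 : ℝ), 0 < κ j * (D j + η * B j + η ^ 2 * C j) := by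
    intro j
    rcases hκ j with hD | ⟨hD, hk⟩ | ⟨hD, hB, hk⟩
    · have hcont : Continuous fun η : ℝ => κ j * (D j + η * B j + η ^ 2 * C j) := by fun_prop
      have h0 : (0 : ℝ) < κ j * (D j + 0 * B j + 0 ^ 2 * C j) := by simpa using hD
      exact ((hcont.tendsto 0).eventually_const_lt h0).filter_mono nhdsWithin_le_nhds
    · have hcont : Continuous fun η : ℝ => κ j * B j + η * (κ j * C j) := by fun_prop
      have h0 : (0 : ℝ) < κ j * B j + 0 * (κ j * C j) := by simpa using hk
      have h1 : ∀ᶠ η in 𝓝[>] (0 : ℝ), 0 < κ j * B j + η * (κ j * C j) :=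
        ((hcont.tendsto 0).eventually_const_lt h0).filter_mono nhdsWithin_le_nhds
      have h2 : ∀ᶠ η in 𝓝[>] (0 : ℝ), 0 < η := eventually_mem_nhdsWithin
      filter_upwards [h1, h2] with η hη hη0
      rw [hD]
      have : κ j * (0 + η * B j + η ^ 2 * C j) = η * (κ j * B j + η * (κ j * C j)) := by ring
      rw [this]
      exact mul_pos hη0 hη
    · have h2 : ∀ᶠ η in 𝓝[>] (0 : ℝ), 0 < η := eventually_mem_nhdsWithin
      filter_upwards [h2] with η hη0
      rw [hD, hB]
      have : κ j * (0 + η * 0 + η ^ 2 * C j) = η ^ 2 * (κ j * C j) := by ring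
      rw [this]
      exact mul_pos (by positivity) hk
  exact Filter.eventually_all.2 hev

/-! ## §2 The cubic unfolding: an abstract real-variable lemma -/

/-- **Cubic unfolding.**  Near `s = 0` let `|F s − a s³| ≤ M s⁴`, `|G s − b s| ≤ M s²`, `|H s| ≤ M` (`|s| ≤ ρ`), and let `λ > 0` with
`a (a + λ b) < 0` (the shifted cubic coefficient flips sign; e.g. `λ = −2a/b` when `ab < 0`).  Then for all small `s > 0`, with `η = λ s²`, the shifted
values `V(±s) = F(±s) + η G(±s) + η² H(±s)` satisfy `0 < a·V(−s)` and `a·V(s) < 0` — the two new sign alternations that a triple zero `a s³` unfolds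
into. [folklore] -/
theorem cubic_unfolding_signs {F G H : ℝ → ℝ} {a b M ρ lam : ℝ} (hρ : 0 < ρ) (hM : 0 ≤ M) (hlam : 0 < lam)
    (hflip : a * (a + lam * b) < 0)
    (hF : ∀ s, |s| ≤ ρ → |F s - a * s ^ 3| ≤ M * s ^ 4) (hG : ∀ s, |s| ≤ ρ → |G s - b * s| ≤ M * s ^ 2)
    (hH : ∀ s, |s| ≤ ρ → |H s| ≤ M) :
    ∀ᶠ s in 𝓝[>] (0 : ℝ),
      0 < a * (F (-s) + (lam * s ^ 2) * G (-s) + (lam * s ^ 2) ^ 2 * H (-s)) ∧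
      a * (F s + (lam * s ^ 2) * G s + (lam * s ^ 2) ^ 2 * H s) < 0 := by
  -- the error constant and the margin
  set Cst : ℝ := |a| * M * (1 + lam + lam ^ 2) with hCst
  have hCst0 : 0 ≤ Cst := by positivity
  set m : ℝ := -(a * (a + lam * b)) with hm
  have hm0 : 0 < m := by rw [hm]; linarith
  have h1 : ∀ᶠ s in 𝓝[>] (0 : ℝ), 0 < s := eventually_mem_nhdsWithin
  have h2 : ∀ᶠ s in 𝓝[>] (0 : ℝ), s < min ρ (m / (Cst + 1)) := by
    have : (0 : ℝ) < min ρ (m / (Cst + 1)) := lt_min hρ (div_pos hm0 (by linarith))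
    exact (eventually_lt_nhds this |>.filter_mono nhdsWithin_le_nhds) |>.mono fun s hs => by simpa using hs
  filter_upwards [h1, h2] with s hs0 hs1
  have hsρ : s ≤ ρ := (hs1.le.trans (min_le_left _ _))
  have hsm : s < m / (Cst + 1) := lt_of_lt_of_le hs1 (min_le_right _ _)
  have hsm' : (Cst + 1) * s < m := by rwa [lt_div_iff₀ (by linarith), mul_comm] at hsm
  have habs : |s| ≤ ρ := by rw [abs_of_pos hs0]; exact hsρ
  have habs' : |(-s)| ≤ ρ := by rw [abs_neg, abs_of_pos hs0]; exact hsρ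
  -- generic bound: |x| ≤ y ⇒ −|a| y ≤ a x ≤ |a| y
  have key : ∀ x y : ℝ, |x| ≤ y → -( |a| * y) ≤ a * x ∧ a * x ≤ |a| * y := by
    intro x y hxy
    have : |a * x| ≤ |a| * y := by rw [abs_mul]; exact mul_le_mul_of_nonneg_left hxy (abs_nonneg a)
    exact ⟨by linarith [neg_abs_le (a * x)], by linarith [le_abs_self (a * x)]⟩
  have hs2 : 0 < s ^ 2 := by positivity
  have hs3 : 0 < s ^ 3 := by positivity
  have hls2 : 0 ≤ lam * s ^ 2 := by positivity
  have hl2s4 : 0 ≤ lam ^ 2 * s ^ 4 := by positivity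
  have hCs : Cst * s ^ 4 < m * s ^ 3 := by
    have := mul_lt_mul_of_pos_right hsm' hs3
    nlinarith [hs3, hCst0]
  have hCexp : Cst * s ^ 4 = |a| * M * s ^ 4 + lam * (|a| * M * s ^ 4) + lam ^ 2 * (|a| * M * s ^ 4) := by
    rw [hCst]; ring
  have hs4' : (-s) ^ 4 = s ^ 4 := by ring
  have hs3' : (-s) ^ 3 = -(s ^ 3) := by ring
  have hs2' : (-s) ^ 2 = s ^ 2 := by ring
  constructor
  · -- at `−s`
    have eF := (key _ _ (hF (-s) habs')).1
    have eG := (key _ _ (hG (-s) habs')).1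
    have eH := (key _ _ (hH (-s) habs')).1
    rw [hs4'] at eF
    rw [hs2'] at eG
    have eG2 := mul_le_mul_of_nonneg_left eG hls2
    have eH2 := mul_le_mul_of_nonneg_left eH hl2s4
    have hexp : a * (F (-s) + (lam * s ^ 2) * G (-s) + (lam * s ^ 2) ^ 2 * H (-s))
        = m * s ^ 3 + (a * (F (-s) - a * (-s) ^ 3) + lam * s ^ 2 * (a * (G (-s) - b * (-s)))
          + lam ^ 2 * s ^ 4 * (a * H (-s))) := by rw [hm]; ring
    rw [hexp]
    have e2 : -(lam * (|a| * M * s ^ 4)) ≤ lam * s ^ 2 * (a * (G (-s) - b * (-s))) := by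
      have : lam * s ^ 2 * -(|a| * (M * s ^ 2)) = -(lam * (|a| * M * s ^ 4)) := by ring
      rw [← this]; exact eG2
    have e3 : -(lam ^ 2 * (|a| * M * s ^ 4)) ≤ lam ^ 2 * s ^ 4 * (a * H (-s)) := by
      have : lam ^ 2 * s ^ 4 * -(|a| * M) = -(lam ^ 2 * (|a| * M * s ^ 4)) := by ring
      rw [← this]; exact eH2
    have e1 : -(|a| * M * s ^ 4) ≤ a * (F (-s) - a * (-s) ^ 3) := by
      have : -(|a| * (M * s ^ 4)) = -(|a| * M * s ^ 4) := by ring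
      rw [← this]; exact eF
    linarith
  · -- at `s`
    have eF := (key _ _ (hF s habs)).2
    have eG := (key _ _ (hG s habs)).2
    have eH := (key _ _ (hH s habs)).2
    have eG2 := mul_le_mul_of_nonneg_left eG hls2
    have eH2 := mul_le_mul_of_nonneg_left eH hl2s4
    have hexp : a * (F s + (lam * s ^ 2) * G s + (lam * s ^ 2) ^ 2 * H s)
        = -(m * s ^ 3) + (a * (F s - a * s ^ 3) + lam * s ^ 2 * (a * (G s - b * s))
          + lam ^ 2 * s ^ 4 * (a * H s)) := by rw [hm]; ring
    rw [hexp]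
    have e2 : lam * s ^ 2 * (a * (G s - b * s)) ≤ lam * (|a| * M * s ^ 4) := by
      have : lam * s ^ 2 * (|a| * (M * s ^ 2)) = lam * (|a| * M * s ^ 4) := by ring
      rw [← this]; exact eG2
    have e3 : lam ^ 2 * s ^ 4 * (a * H s) ≤ lam ^ 2 * (|a| * M * s ^ 4) := by
      have : lam ^ 2 * s ^ 4 * (|a| * M) = lam ^ 2 * (|a| * M * s ^ 4) := by ring
      rw [← this]; exact eH2
    have e1 : a * (F s - a * s ^ 3) ≤ |a| * M * s ^ 4 := by
      have : |a| * (M * s ^ 4) = |a| * M * s ^ 4 := by ring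
      rw [← this]; exact eF
    linarith


/-! ## §3 Counting zeros in pairwise disjoint brackets (unordered index) -/

/-- **Zeros in pairwise disjoint sign-change brackets are distinct**: a continuous `f` with a sign change on each of finitely many pairwise disjoint open
intervals has at least that many zeros (the index set need not be ordered). [folklore] -/
theorem card_le_ncard_zero_of_disjoint_brackets {ι : Type*} [Fintype ι] (f : ℝ → ℝ) (hf : Continuous f)
    (a b : ι → ℝ) (hab : ∀ k, a k < b k) (hdisj : ∀ k k', k ≠ k' → b k ≤ a k' ∨ b k' ≤ a k)
    (hsign : ∀ k, f (a k) * f (b k) < 0) (hfin : {t | f t = 0}.Finite) :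
    Fintype.card ι ≤ {t | f t = 0}.ncard := by
  classical
  have hz : ∀ k, ∃ z ∈ Set.Ioo (a k) (b k), f z = 0 :=
    fun k => exists_zero_of_mul_neg (hab k) hf.continuousOn (hsign k)
  choose z hz0 hz1 using hz
  have hinj : Function.Injective z := by
    intro k k' hkk
    by_contra hne
    rcases hdisj k k' hne with h | h
    · have h1 := (hz0 k).2; have h2 := (hz0 k').1; rw [hkk] at h1; linarith
    · have h1 := (hz0 k').2; have h2 := (hz0 k).1; rw [← hkk] at h1; linarith
  have hsub : Set.range z ⊆ {t | f t = 0} := by rintro _ ⟨k, rfl⟩; exact hz1 k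
  calc Fintype.card ι = (Set.range z).ncard := by
        rw [Set.ncard_range_of_injective hinj, Nat.card_eq_fintype_card]
    _ ≤ _ := Set.ncard_le_ncard hsub hfin

/-! ## §4 The triple-zero lift -/

/-- **THE TRIPLE-ZERO LIFT (modulo explicit cubic Taylor bounds).**  Real exponents `δ`, symmetric letters `S_l`, symmetric shift letters `T_l`
(`P(t) = Σ e^{δ_l t} S_l`, `Q(t) = Σ e^{δ_l t} T_l`), `19` increasing log-time abscissae `τ` with alternating virtual signs `κ` and the Q-lift sign data of
#46 at every abscissa (`0 < κ_j det P`, or `det P = 0 ∧ 0 < κ_j polar`, or `det P = polar = 0 ∧ 0 < κ_j det Q`).  In the gap `(τ_{j⋆}, τ_{j⋆+1})` sits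
a point `t⋆` where `det P`, `polar(P,Q)` and `det Q` obey CUBIC TAYLOR BOUNDS `|det P(t⋆+s) − a s³| ≤ M s⁴`, `|polar(t⋆+s) − b s| ≤ M s²`,
`|det Q(t⋆+s)| ≤ M` for `|s| ≤ ρ` (a zero of order three of `det P` at which the push `polar` vanishes to first order), with `a κ_{j⋆} < 0` and
`a (a + λ b) < 0` for some `λ > 0` (e.g. `λ = −2a/b`: the shift must tilt the cubic against its leading sign).  Then `δ ∈ TwentyLocus`: for small
`s > 0` and `η = λ s²` the letters `S_l + η T_l` have `20` sign alternations along `τ` with the two extra abscissae `t⋆ ∓ s` inserted in the gap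
(`cubic_unfolding_signs`), hence `20` zeros by bracket counting. [this work] -/
theorem mem_twentyLocus_of_tripleZero (δ : Fin 6 → ℝ) (S T : Fin 6 → Matrix (Fin 2) (Fin 2) ℝ)
    (hS : ∀ l, (S l).IsSymm) (hT : ∀ l, (T l).IsSymm) (τ : Fin 19 → ℝ) (hτ : StrictMono τ) (κ : Fin 19 → ℝ)
    (hκ : ∀ j, 0 < κ j * (∑ l, Real.exp (δ l * τ j) • S l).det ∨
      ((∑ l, Real.exp (δ l * τ j) • S l).det = 0 ∧
        0 < κ j * (((∑ l, Real.exp (δ l * τ j) • S l) + (∑ l, Real.exp (δ l * τ j) • T l)).det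
              - (∑ l, Real.exp (δ l * τ j) • S l).det - (∑ l, Real.exp (δ l * τ j) • T l).det)) ∨
      ((∑ l, Real.exp (δ l * τ j) • S l).det = 0 ∧
        ((∑ l, Real.exp (δ l * τ j) • S l) + (∑ l, Real.exp (δ l * τ j) • T l)).det
              - (∑ l, Real.exp (δ l * τ j) • S l).det - (∑ l, Real.exp (δ l * τ j) • T l).det = 0 ∧
        0 < κ j * (∑ l, Real.exp (δ l * τ j) • T l).det))
    (halt : ∀ j : Fin 18, κ j.castSucc * κ j.succ < 0)
    (jstar : Fin 18) (tstar a b M ρ lam : ℝ) (ht1 : τ jstar.castSucc < tstar) (ht2 : tstar < τ jstar.succ)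
    (hρ : 0 < ρ) (hM : 0 ≤ M) (hlam : 0 < lam) (haκ : a * κ jstar.castSucc < 0) (hflip : a * (a + lam * b) < 0)
    (hF : ∀ s, |s| ≤ ρ → |(∑ l, Real.exp (δ l * (tstar + s)) • S l).det - a * s ^ 3| ≤ M * s ^ 4)
    (hG : ∀ s, |s| ≤ ρ → |(((∑ l, Real.exp (δ l * (tstar + s)) • S l) + (∑ l, Real.exp (δ l * (tstar + s)) • T l)).det
              - (∑ l, Real.exp (δ l * (tstar + s)) • S l).det - (∑ l, Real.exp (δ l * (tstar + s)) • T l).det) - b * s| ≤ M * s ^ 2)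
    (hH : ∀ s, |s| ≤ ρ → |(∑ l, Real.exp (δ l * (tstar + s)) • T l).det| ≤ M) :
    δ ∈ TwentyLocus := by
  classical
  -- abbreviations
  set D : ℝ → ℝ := fun t => (∑ l, Real.exp (δ l * t) • S l).det with hD
  set Bp : ℝ → ℝ := fun t => ((∑ l, Real.exp (δ l * t) • S l) + (∑ l, Real.exp (δ l * t) • T l)).det
      - (∑ l, Real.exp (δ l * t) • S l).det - (∑ l, Real.exp (δ l * t) • T l).det with hBp
  set Cq : ℝ → ℝ := fun t => (∑ l, Real.exp (δ l * t) • T l).det with hCq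
  -- the shifted determinant as a function of `η` and `t`
  have hval : ∀ η t, (∑ l, Real.exp (δ l * t) • (S l + η • T l)).det = D t + η * Bp t + η ^ 2 * Cq t := by
    intro η t; rw [expPencil_pencilShift, det_add_smul_fin_two]
  -- (1) the 19 old abscissae keep their virtual signs for all small `η`
  have hold : ∀ᶠ η in 𝓝[>] (0 : ℝ), ∀ j, 0 < κ j * (D (τ j) + η * Bp (τ j) + η ^ 2 * Cq (τ j)) :=
    eventually_pencilShift_signs (fun j => D (τ j)) (fun j => Bp (τ j)) (fun j => Cq (τ j)) κ hκ
  -- transported to the variable `s` (`η = λ s²`)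
  have hηs : Tendsto (fun s : ℝ => lam * s ^ 2) (𝓝[>] 0) (𝓝[>] 0) := by
    apply tendsto_nhdsWithin_of_tendsto_nhds_of_eventually_within
    · have : Continuous fun s : ℝ => lam * s ^ 2 := by fun_prop
      simpa using (this.tendsto 0).mono_left nhdsWithin_le_nhds
    · filter_upwards [self_mem_nhdsWithin] with s hs
      exact mul_pos hlam (pow_pos (Set.mem_Ioi.1 hs) 2)
  have hold' : ∀ᶠ s in 𝓝[>] (0 : ℝ), ∀ j, 0 < κ j * (D (τ j) + (lam * s ^ 2) * Bp (τ j) + (lam * s ^ 2) ^ 2 * Cq (τ j)) :=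
    hηs.eventually hold
  -- (2) the two new abscissae
  have hnew := cubic_unfolding_signs (F := fun s => D (tstar + s)) (G := fun s => Bp (tstar + s)) (H := fun s => Cq (tstar + s))
    hρ hM hlam hflip hF hG hH
  -- (3) the new abscissae stay in the gap
  have hgap : ∀ᶠ s in 𝓝[>] (0 : ℝ), 0 < s ∧ τ jstar.castSucc < tstar - s ∧ tstar + s < τ jstar.succ := by
    have h1 : ∀ᶠ s in 𝓝[>] (0 : ℝ), 0 < s := eventually_mem_nhdsWithin
    have h2 : ∀ᶠ s in 𝓝[>] (0 : ℝ), s < min (tstar - τ jstar.castSucc) (τ jstar.succ - tstar) := by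
      have : (0 : ℝ) < min (tstar - τ jstar.castSucc) (τ jstar.succ - tstar) := lt_min (by linarith) (by linarith)
      exact (eventually_lt_nhds this).filter_mono nhdsWithin_le_nhds
    filter_upwards [h1, h2] with s hs hs'
    exact ⟨hs, by linarith [lt_of_lt_of_le hs' (min_le_left _ _)], by linarith [lt_of_lt_of_le hs' (min_le_right _ _)]⟩
  obtain ⟨s, hs_old, ⟨hs_newL, hs_newR⟩, hs0, hsL, hsR⟩ := (hold'.and (hnew.and hgap)).exists
  set η : ℝ := lam * s ^ 2 with hη
  set S' : Fin 6 → Matrix (Fin 2) (Fin 2) ℝ := fun l => S l + η • T l with hS'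
  set f : ℝ → ℝ := fun t => (∑ l, Real.exp (δ l * t) • S' l).det with hf
  have hf_eq : ∀ t, f t = D t + η * Bp t + η ^ 2 * Cq t := fun t => hval η t
  have hf_cont : Continuous f := continuous_det_expPencil δ S'
  -- signs of `f` at the old abscissae and the two new ones
  have hfold : ∀ j, 0 < κ j * f (τ j) := fun j => by rw [hf_eq]; exact hs_old j
  have hfL : 0 < a * f (tstar - s) := by
    rw [hf_eq, sub_eq_add_neg]; exact hs_newL
  have hfR : a * f (tstar + s) < 0 := by
    rw [hf_eq]; exact hs_newR
  -- the old alternation gives finiteness of the zero set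
  have halt' : ∀ j : Fin 18, f (τ j.castSucc) * f (τ j.succ) < 0 := fun j =>
    NullEnd.neg_of_sign_transfer (hfold j.castSucc) (hfold j.succ) (halt j)
  have hfin : {t : ℝ | f t = 0}.Finite := (le_ncard_of_alternations_exp δ S' (by norm_num) τ hτ halt').1
  -- twenty disjoint brackets: the 17 old gaps other than `jstar`, and the three sub-gaps of `jstar`
  let ι := {k : Fin 18 // k ≠ jstar} ⊕ Fin 3
  let A : ι → ℝ := fun k => match k with
    | Sum.inl k => τ k.1.castSucc
    | Sum.inr i => (![τ jstar.castSucc, tstar - s, tstar + s] : Fin 3 → ℝ) i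
  let Bq : ι → ℝ := fun k => match k with
    | Sum.inl k => τ k.1.succ
    | Sum.inr i => (![tstar - s, tstar + s, τ jstar.succ] : Fin 3 → ℝ) i
  have hfj := hfold jstar.castSucc
  have hfj1 := hfold jstar.succ
  have hκκ := halt jstar
  have hsignL : f (τ jstar.castSucc) * f (tstar - s) < 0 := by
    -- `κ f(τ_{j⋆}) > 0`, `a κ < 0`, `a f(t⋆ − s) > 0` ⇒ `f(τ_{j⋆}) f(t⋆−s) < 0`
    have h1 : 0 < (κ jstar.castSucc * f (τ jstar.castSucc)) * (a * f (tstar - s)) := mul_pos hfj hfL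
    have h2 : (κ jstar.castSucc * f (τ jstar.castSucc)) * (a * f (tstar - s))
        = (a * κ jstar.castSucc) * (f (τ jstar.castSucc) * f (tstar - s)) := by ring
    rw [h2] at h1
    exact (neg_of_mul_pos_right h1 haκ.le) |> fun h => by
      rcases lt_trichotomy (f (τ jstar.castSucc) * f (tstar - s)) 0 with h' | h' | h'
      · exact h'
      · rw [h', mul_zero] at h1; exact absurd h1 (lt_irrefl 0)
      · exact absurd (mul_neg_of_neg_of_pos haκ h') (not_lt.2 h1.le)
  have hsignM : f (tstar - s) * f (tstar + s) < 0 := by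
    have h1 : (a * f (tstar - s)) * (a * f (tstar + s)) < 0 := mul_neg_of_pos_of_neg hfL hfR
    have h2 : (a * f (tstar - s)) * (a * f (tstar + s)) = a ^ 2 * (f (tstar - s) * f (tstar + s)) := by ring
    rw [h2] at h1
    have ha2 : 0 < a ^ 2 := by
      have : a ≠ 0 := by intro h0; rw [h0, zero_mul] at haκ; exact lt_irrefl _ haκ
      positivity
    rcases lt_trichotomy (f (tstar - s) * f (tstar + s)) 0 with h' | h' | h'
    · exact h'
    · rw [h', mul_zero] at h1; exact absurd h1 (lt_irrefl 0)
    · exact absurd (mul_pos ha2 h') (not_lt.2 h1.le)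
  have hsignR : f (tstar + s) * f (τ jstar.succ) < 0 := by
    -- `a f(t⋆+s) < 0`, `a κ_{j⋆} < 0`, `κ_{j⋆} κ_{j⋆+1} < 0`, `κ_{j⋆+1} f(τ_{j⋆+1}) > 0`
    have h1 : 0 < (a * f (tstar + s)) * (a * κ jstar.castSucc) := mul_pos_of_neg_of_neg hfR haκ
    have h2 : (κ jstar.castSucc * κ jstar.succ) * (κ jstar.succ * f (τ jstar.succ)) < 0 := mul_neg_of_neg_of_pos hκκ hfj1
    -- combine: sign f(t⋆+s) = −sign a = sign κ_{j⋆} = −sign κ_{j⋆+1} = −sign f(τ_{j⋆+1})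
    have ha : a ≠ 0 := by intro h0; rw [h0, zero_mul] at haκ; exact lt_irrefl _ haκ
    have hk1 : κ jstar.succ ≠ 0 := by intro h0; rw [h0, mul_zero] at hκκ; exact lt_irrefl _ hκκ
    have h3 : 0 < ((a * f (tstar + s)) * (a * κ jstar.castSucc)) * -((κ jstar.castSucc * κ jstar.succ) * (κ jstar.succ * f (τ jstar.succ))) :=
      mul_pos h1 (by linarith)
    have h4 : ((a * f (tstar + s)) * (a * κ jstar.castSucc)) * -((κ jstar.castSucc * κ jstar.succ) * (κ jstar.succ * f (τ jstar.succ)))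
        = -(a ^ 2 * κ jstar.castSucc ^ 2 * κ jstar.succ ^ 2) * (f (tstar + s) * f (τ jstar.succ)) := by ring
    rw [h4] at h3
    have hc : 0 < a ^ 2 * κ jstar.castSucc ^ 2 * κ jstar.succ ^ 2 := by
      have hk0 : κ jstar.castSucc ≠ 0 := by intro h0; rw [h0, mul_zero] at haκ; exact lt_irrefl _ haκ
      positivity
    rcases lt_trichotomy (f (tstar + s) * f (τ jstar.succ)) 0 with h' | h' | h'
    · exact h'
    · rw [h', mul_zero] at h3; exact absurd h3 (lt_irrefl 0)
    · nlinarith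
  -- the brackets
  let ι := {k : Fin 18 // k ≠ jstar} ⊕ Fin 3
  let A : ι → ℝ := Sum.elim (fun k => τ k.1.castSucc) (![τ jstar.castSucc, tstar - s, tstar + s] : Fin 3 → ℝ)
  let Bq : ι → ℝ := Sum.elim (fun k => τ k.1.succ) (![tstar - s, tstar + s, τ jstar.succ] : Fin 3 → ℝ)
  have hAB : ∀ k, A k < Bq k := by
    rintro (⟨k, hk⟩ | i)
    · exact hτ (Fin.castSucc_lt_succ)
    · fin_cases i
      · simpa [A, Bq] using hsL
      · show tstar - s < tstar + s; linarith
      · simpa [A, Bq] using hsR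
  have hsgn : ∀ k, f (A k) * f (Bq k) < 0 := by
    rintro (⟨k, hk⟩ | i)
    · exact halt' k
    · fin_cases i
      · simpa [A, Bq] using hsignL
      · simpa [A, Bq] using hsignM
      · simpa [A, Bq] using hsignR
  have hdisj : ∀ k k', k ≠ k' → Bq k ≤ A k' ∨ Bq k' ≤ A k := by
    rintro (⟨k, hk⟩ | i) (⟨k', hk'⟩ | i') hne
    · -- two old gaps
      have hkk : k ≠ k' := fun h => hne (by subst h; rfl)
      rcases lt_or_gt_of_ne hkk with h | h
      · left; exact hτ.monotone (Fin.succ_le_castSucc_iff.2 h)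
      · right; exact hτ.monotone (Fin.succ_le_castSucc_iff.2 h)
    · -- old gap vs new sub-gap
      rcases lt_or_gt_of_ne hk with h | h
      · left
        have h1 : τ k.succ ≤ τ jstar.castSucc := hτ.monotone (Fin.succ_le_castSucc_iff.2 h)
        show τ k.succ ≤ (![τ jstar.castSucc, tstar - s, tstar + s] : Fin 3 → ℝ) i'
        fin_cases i' <;> simp <;> linarith
      · right
        have h1 : τ jstar.succ ≤ τ k.castSucc := hτ.monotone (Fin.succ_le_castSucc_iff.2 h)
        show (![tstar - s, tstar + s, τ jstar.succ] : Fin 3 → ℝ) i' ≤ τ k.castSucc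
        fin_cases i' <;> simp <;> linarith
    · rcases lt_or_gt_of_ne hk' with h | h
      · right
        have h1 : τ k'.succ ≤ τ jstar.castSucc := hτ.monotone (Fin.succ_le_castSucc_iff.2 h)
        show τ k'.succ ≤ (![τ jstar.castSucc, tstar - s, tstar + s] : Fin 3 → ℝ) i
        fin_cases i <;> simp <;> linarith
      · left
        have h1 : τ jstar.succ ≤ τ k'.castSucc := hτ.monotone (Fin.succ_le_castSucc_iff.2 h)
        show (![tstar - s, tstar + s, τ jstar.succ] : Fin 3 → ℝ) i ≤ τ k'.castSucc
        fin_cases i <;> simp <;> linarith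
    · -- two new sub-gaps
      show (![tstar - s, tstar + s, τ jstar.succ] : Fin 3 → ℝ) i ≤ (![τ jstar.castSucc, tstar - s, tstar + s] : Fin 3 → ℝ) i'
        ∨ (![tstar - s, tstar + s, τ jstar.succ] : Fin 3 → ℝ) i' ≤ (![τ jstar.castSucc, tstar - s, tstar + s] : Fin 3 → ℝ) i
      fin_cases i <;> fin_cases i' <;> simp at hne ⊢ <;> first | (left; linarith) | (right; linarith)
  have hcount := card_le_ncard_zero_of_disjoint_brackets f hf_cont A Bq hAB hdisj hsgn hfin
  have hcard : Fintype.card ι = 20 := by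
    simp [ι, Fintype.card_sum, Fintype.card_subtype_compl, Fintype.card_fin]
  refine ⟨S', fun l => (hS l).add ((hT l).smul η), ?_⟩
  rw [ncard_rpow_eq_ncard_exp, ← hcard]
  exact hcount

end Summit.ValiantsHypothesis.ValiantsHypothesis.Theorems.LacunarySymmetroidMatrixDescartes.WallBubbling
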